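import Summits.QuantumFields.YangMills.Theorems.ColdStartUniversalityColdStartSolutionsExist
import Literature.Probability.Process.ItoIntegralConstruction
import HarnessLib

/-!
# Route `ColdStartUniversality` (rung input (M), crux K_A1 stmt-QuantumFields-24809): RIEMANN–ITÔ sums — dyadic sampling
# approximates a path-continuous adapted integrand; limits in probability are unique

Helper file (seat `ym-line-csu-p1`, g4); generic tools (any filtration, any probability space) for the splicing proof
of the flow (cocycle) property:

* `isApproxSeq_sample_of_continuous` — for an adapted, jointly measurable integrand with a.s. continuous paths, the
  dyadic samples `SimpleProcess.sample σ` (tree, `ItoIntegralConstruction`) form an approximating sequence in the sense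
  of `SimpleProcess.IsApproxSeq` (pathwise `tendsto_lintegral_sample_sub_sq` + dominated convergence); hence, by the
  universal clause of `IsItoIntegral`, their elementary integrals converge u.c.p. to ANY Itô integral of `σ`
  (`tendstoUCP_integral_sample`);
* `tendsto_measure_of_tendstoUCP` — u.c.p. convergence gives convergence in probability at each time;
* `ae_eq_of_tendsto_measure` — two limits in probability of one sequence agree almost surely.

No definition, no sorry.  RECORD-rung R3 plumbing; nothing here bears on the mass gap.
-/

set_option autoImplicit false

noncomputable section

namespace Summit.QuantumFields.YangMills.Theorems.ColdStartUniversality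

open MeasureTheory ProbabilityTheory Filter Topology
open scoped NNReal ENNReal BigOperators
open Literature Literature.Probability.Process

variable {Ω : Type*} {mΩ : MeasurableSpace Ω} {P : Measure Ω} {𝓕 : Filtration ℝ≥0 mΩ}

/-- **Dyadic sampling approximates a path-continuous adapted integrand** (`SimpleProcess.IsApproxSeq`): jointly
measurable `σ`, adapted, with a.s. continuous paths. [cite: RevuzYor1999, Ch. IV Prop. (2.13)] -/
theorem isApproxSeq_sample_of_continuous [IsProbabilityMeasure P] {σ : ℝ≥0 → Ω → ℝ} (hσ : Adapted 𝓕 σ)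
    (hσm : Measurable fun p : Ω × ℝ => σ p.2.toNNReal p.1) (hσc : ∀ᵐ ω ∂P, Continuous (σ · ω)) :
    SimpleProcess.IsApproxSeq (SimpleProcess.sample σ hσ) σ P := by
  intro t ε hε
  -- the random variables `Z_n = ∫₀ᵗ (σₙ - σ)²`
  have hZm : ∀ n, Measurable fun ω => ∫⁻ s in Set.Icc (0 : ℝ) t,
      ENNReal.ofReal (((SimpleProcess.sample σ hσ n).toProcess s.toNNReal ω - σ s.toNNReal ω) ^ 2) := by
    intro n
    have hg : Measurable fun p : Ω × ℝ =>
        ENNReal.ofReal (((SimpleProcess.sample σ hσ n).toProcess p.2.toNNReal p.1 - σ p.2.toNNReal p.1) ^ 2) :=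
      (((SimpleProcess.sample σ hσ n).measurable_toProcess_prod.sub hσm).pow_const 2).ennreal_ofReal
    exact hg.lintegral_prod_right'
  have hSm : ∀ n, MeasurableSet {ω | ENNReal.ofReal ε ≤ ∫⁻ s in Set.Icc (0 : ℝ) t,
      ENNReal.ofReal (((SimpleProcess.sample σ hσ n).toProcess s.toNNReal ω - σ s.toNNReal ω) ^ 2)} :=
    fun n => measurableSet_le measurable_const (hZm n)
  -- indicators tend to zero along a.e. path
  have hlim : ∀ᵐ ω ∂P, Tendsto (fun n => ({ω | ENNReal.ofReal ε ≤ ∫⁻ s in Set.Icc (0 : ℝ) t,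
      ENNReal.ofReal (((SimpleProcess.sample σ hσ n).toProcess s.toNNReal ω - σ s.toNNReal ω) ^ 2)}).indicator
        (fun _ => (1 : ℝ≥0∞)) ω) atTop (𝓝 0) := by
    filter_upwards [hσc] with ω hω
    have hZ := SimpleProcess.tendsto_lintegral_sample_sub_sq σ hσ hω t
    have hev : ∀ᶠ n in atTop, ({ω | ENNReal.ofReal ε ≤ ∫⁻ s in Set.Icc (0 : ℝ) t,
        ENNReal.ofReal (((SimpleProcess.sample σ hσ n).toProcess s.toNNReal ω - σ s.toNNReal ω) ^ 2)}).indicator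
          (fun _ => (1 : ℝ≥0∞)) ω = 0 := by
      have hε' : (0 : ℝ≥0∞) < ENNReal.ofReal ε := ENNReal.ofReal_pos.2 hε
      filter_upwards [(tendsto_order.1 hZ).2 _ hε'] with n hn
      rw [Set.indicator_of_notMem]
      exact fun h => absurd hn (not_lt.2 h)
    exact tendsto_const_nhds.congr' (hev.mono fun n hn => hn.symm)
  have hmeas : ∀ n, P {ω | ENNReal.ofReal ε ≤ ∫⁻ s in Set.Icc (0 : ℝ) t,
      ENNReal.ofReal (((SimpleProcess.sample σ hσ n).toProcess s.toNNReal ω - σ s.toNNReal ω) ^ 2)} =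
      ∫⁻ ω, ({ω | ENNReal.ofReal ε ≤ ∫⁻ s in Set.Icc (0 : ℝ) t,
        ENNReal.ofReal (((SimpleProcess.sample σ hσ n).toProcess s.toNNReal ω - σ s.toNNReal ω) ^ 2)}).indicator
          (fun _ => (1 : ℝ≥0∞)) ω ∂P := fun n => by
    rw [lintegral_indicator (hSm n), setLIntegral_const, one_mul]
  have h0 : (0 : ℝ≥0∞) = ∫⁻ _ω, 0 ∂P := by rw [lintegral_zero]
  have hgoal : Tendsto (fun n => ∫⁻ ω, ({ω | ENNReal.ofReal ε ≤ ∫⁻ s in Set.Icc (0 : ℝ) t,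
      ENNReal.ofReal (((SimpleProcess.sample σ hσ n).toProcess s.toNNReal ω - σ s.toNNReal ω) ^ 2)}).indicator
        (fun _ => (1 : ℝ≥0∞)) ω ∂P) atTop (𝓝 0) := by
    rw [h0]
    refine tendsto_lintegral_of_dominated_convergence (fun _ => 1)
      (fun n => (measurable_const.indicator (hSm n))) (fun n => Eventually.of_forall fun ω => ?_) ?_ hlim
    · exact Set.indicator_le_self' (fun _ _ => zero_le) ω
    · rw [lintegral_const, one_mul]
      exact measure_ne_top _ _
  exact hgoal.congr' (Eventually.of_forall fun n => (hmeas n).symm)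

/-- **Riemann–Itô sums converge to the Itô integral**: for ANY Itô integral `K = ∫ σ dB` (tree `IsItoIntegral`) of a
path-continuous adapted integrand, the elementary integrals of the dyadic samples converge u.c.p. to `K` (universal
clause of the characterisation). [cite: RevuzYor1999, Ch. IV Prop. (2.13)] -/
theorem tendstoUCP_integral_sample [IsProbabilityMeasure P] {σ B K : ℝ≥0 → Ω → ℝ} (hσ : Adapted 𝓕 σ)
    (hσm : Measurable fun p : Ω × ℝ => σ p.2.toNNReal p.1) (hσc : ∀ᵐ ω ∂P, Continuous (σ · ω))
    (hK : IsItoIntegral σ B K 𝓕 P) :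
    TendstoUCP (fun n => (SimpleProcess.sample σ hσ n).integral B) K P :=
  hK.2.2.2.2 _ (isApproxSeq_sample_of_continuous hσ hσm hσc)

/-- u.c.p. convergence gives convergence in probability at each fixed time. [folklore] -/
theorem tendsto_measure_of_tendstoUCP {Y : ℕ → ℝ≥0 → Ω → ℝ} {K : ℝ≥0 → Ω → ℝ} (h : TendstoUCP Y K P)
    (t : ℝ≥0) {ε : ℝ} (hε : 0 < ε) :
    Tendsto (fun n => P {ω | ε ≤ |Y n t ω - K t ω|}) atTop (𝓝 0) := by
  refine tendsto_of_tendsto_of_tendsto_of_le_of_le tendsto_const_nhds (h t ε hε) (fun n => zero_le) fun n => ?_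
  exact measure_mono fun ω hω => ⟨t, le_rfl, hω⟩

/-- **Limits in probability are almost surely unique**: if `A n → Z` and `A n → Z'` in probability then `Z = Z'` a.s.
(no measurability needed: measures are outer measures). [folklore] -/
theorem ae_eq_of_tendsto_measure {A : ℕ → Ω → ℝ} {Z Z' : Ω → ℝ}
    (hZ : ∀ ε : ℝ, 0 < ε → Tendsto (fun n => P {ω | ε ≤ |A n ω - Z ω|}) atTop (𝓝 0))
    (hZ' : ∀ ε : ℝ, 0 < ε → Tendsto (fun n => P {ω | ε ≤ |A n ω - Z' ω|}) atTop (𝓝 0)) :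
    ∀ᵐ ω ∂P, Z ω = Z' ω := by
  -- for each `ε > 0`, `P{2ε ≤ |Z - Z'|} = 0`
  have key : ∀ ε : ℝ, 0 < ε → P {ω | 2 * ε ≤ |Z ω - Z' ω|} = 0 := by
    intro ε hε
    have hle : ∀ n, P {ω | 2 * ε ≤ |Z ω - Z' ω|} ≤
        P {ω | ε ≤ |A n ω - Z ω|} + P {ω | ε ≤ |A n ω - Z' ω|} := by
      intro n
      refine (measure_mono fun ω hω => ?_).trans (measure_union_le _ _)
      by_contra hcon
      simp only [Set.mem_union, Set.mem_setOf_eq, not_or, not_le] at hcon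
      have h1 : |Z ω - Z' ω| ≤ |A n ω - Z ω| + |A n ω - Z' ω| := by
        have := abs_sub_le (Z ω) (A n ω) (Z' ω)
        rwa [abs_sub_comm (Z ω) (A n ω)] at this
      have h2 : 2 * ε ≤ |Z ω - Z' ω| := hω
      linarith [hcon.1, hcon.2]
    have hlim : Tendsto (fun n => P {ω | ε ≤ |A n ω - Z ω|} + P {ω | ε ≤ |A n ω - Z' ω|}) atTop (𝓝 0) := by
      simpa using (hZ ε hε).add (hZ' ε hε)
    exact le_antisymm (ge_of_tendsto' hlim hle) zero_le
  have hU : {ω | ¬ Z ω = Z' ω} ⊆ ⋃ k : ℕ, {ω | 2 * ((k : ℝ) + 1)⁻¹ ≤ |Z ω - Z' ω|} := by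
    intro ω hω
    have hpos : 0 < |Z ω - Z' ω| := abs_pos.2 (sub_ne_zero.2 hω)
    obtain ⟨k, hk⟩ := exists_nat_one_div_lt (half_pos hpos)
    refine Set.mem_iUnion.2 ⟨k, ?_⟩
    show 2 * ((k : ℝ) + 1)⁻¹ ≤ |Z ω - Z' ω|
    rw [one_div] at hk
    linarith
  refine ae_iff.2 (measure_mono_null hU ?_)
  exact measure_iUnion_null fun k => key _ (by positivity)

end Summit.QuantumFields.YangMills.Theorems.ColdStartUniversality

end
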